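import Literature.NumberTheory.EllipticCurves.BernoulliMeasureMomentsProofs
import Literature.NumberTheory.EllipticCurves.PAdicMeasureInversionProofs
import HarnessLib

/-!
# Character sums of the Kubota–Leopoldt measure `θ E_{1,c}`: `∫ ρ d(θE_{1,c}) = (1 − θρ(c)c) B_{1,θρ}`
# (Lang Ch. 2 §2 Thm. 2.4 at `k = 1` for the twisted character `θρ`)

Lang, *Cyclotomic Fields I and II*, Ch. 2 §2 (PDF p. 38), Thm. 2.4 and its proof: for a function
`ψ` on `ℤ/Mℤ` multiplicative with respect to `c` ("We let `x ↦ cx` in the second integral. Then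
`ψ(c)` comes out as a factor"), `∫ ψ dE_{1,c} = ∑_{x mod M} ψ(x)E_{1,c}(x) = (1 − ψ(c)c) B_{1,ψ}` with
`B_{1,ψ} = ∑_{x mod M} ψ(x) B_1(x/M)` (**B 7**, `k = 1`). The tree's `bernoulliMeasure_zero_eq`
(`BernoulliMeasureMomentsProofs`) is this identity for the `ℤ_p`-valued `N`-periodic twist `θ`
at level `p^0`. This file proves the same identity at level `p^n` for the `ℂ_p`-valued function
`ψ = θ · ρ`, `ρ` a multiplicative character of `ℤ/p^nℤ` with values in `ℂ_p` (a character of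
`Γ`), which is what the interpolation of the Iwasawa function of `θE_{1,c}` at the character point
`T = ρ(γ) − 1` produces (`PAdicMeasureMoments.exists_powerSeries_of_bounded_distribution'`, clause
(iii): `f(ρ(γ) − 1) = ∑_{a mod p^n} ρ(a) μ(a + p^nℤ_p)`; Lang Ch. 4 §3 Thm. 3.2 at the finite-order
characters; Washington Thm. 12.2; Greenberg–Vatsal 2000 (26)/(27)):

* `sum_character_mul_bernoulliMeasure_one` —
  `∑_{a mod p^n} ρ(a)·(θE_{1,c})(a + p^nℤ_p) = (1 − θ(c)ρ(c)c) · ∑_{b mod Np^n} θ(b)ρ(b)B_1(b/(Np^n))`;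
* `sum_character_mul_invUnitsDist` — for the inverted distribution `μ̌` (push-forward of
  `μ|_{ℤ_pˣ}` along `x ↦ x⁻¹`, `PAdicMeasureInversionProofs.invUnitsDist`) of a distribution `μ`,
  `∑_a ρ(a) μ̌(a) = ∑_a ρ⁻¹(a) μ(a)` (a character vanishes on non-units).

Everything is proved; there are no named facts and no new definitions.

## References

* S. Lang, *Cyclotomic Fields I and II*, GTM 121, Springer 1990, Ch. 2 §2 **B 7** (PDF p. 35)
  and Thm. 2.4 with its proof (PDF p. 38); Ch. 4 §2 (operations on measures, PDF pp. 80–82).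
  [LangCyclotomic1990]
-/

noncomputable section

open scoped Classical

open Finset

namespace Literature.NumberTheory.EllipticCurves

variable (p : ℕ) [Fact p.Prime] {N : ℕ} [NeZero N] {c : ℕ} {θ : ℕ → ℤ_[p]}

/-! ### Periodicity and the change of variables `x ↦ cx` -/

omit [NeZero N] in
/-- An `N`-periodic function is constant on residue classes modulo any multiple of `N`. [folklore] -/
private theorem apply_eq_of_modEq' {M : ℕ} (hNM : N ∣ M) (hθ : ∀ b, θ (b + N) = θ b) {x y : ℕ}
    (h : x ≡ y [MOD M]) : θ x = θ y := by
  have hper : ∀ b m : ℕ, θ (b + m * N) = θ b := by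
    intro b m
    induction m with
    | zero => rw [zero_mul, add_zero]
    | succ m ih => rw [Nat.succ_mul, ← add_assoc, hθ, ih]
  obtain ⟨d, rfl⟩ := hNM
  have hx : θ x = θ (x % (N * d)) := by
    conv_lhs => rw [← Nat.mod_add_div x (N * d),
      show N * d * (x / (N * d)) = (d * (x / (N * d))) * N by ring, hper]
  have hy : θ y = θ (y % (N * d)) := by
    conv_lhs => rw [← Nat.mod_add_div y (N * d),
      show N * d * (y / (N * d)) = (d * (y / (N * d))) * N by ring, hper]
  rw [hx, hy]
  exact congrArg θ h

omit [NeZero N] in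
/-- `θ((b·c).val) = θ(c) θ(b.val)` in `ℤ/Mℤ`, `N ∣ M`, for `θ` multiplicative with respect to `c`.
[folklore] -/
private theorem apply_val_mul_natCast {M : ℕ} [NeZero M] (hNM : N ∣ M) (hθ : ∀ b, θ (b + N) = θ b)
    (hθc : ∀ x, θ (c * x) = θ c * θ x) (b : ZMod M) :
    θ (b * (c : ZMod M)).val = θ c * θ b.val := by
  rw [← hθc]
  refine apply_eq_of_modEq' p hNM hθ ?_
  calc (b * (c : ZMod M)).val = b.val * (c % M) % M := by rw [ZMod.val_mul, ZMod.val_natCast]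
    _ ≡ b.val * (c % M) [MOD M] := Nat.mod_modEq _ _
    _ ≡ b.val * c [MOD M] := (Nat.mod_modEq c M).mul_left _
    _ = c * b.val := mul_comm _ _

omit [Fact p.Prime] [NeZero N] in
/-- `c` prime to `Np` is prime to `N p^n`. [folklore] -/
private theorem coprime_mul_pow' (hc : c.Coprime (N * p)) (n : ℕ) : c.Coprime (N * p ^ n) :=
  Nat.Coprime.mul_right (hc.coprime_dvd_right (Dvd.intro _ rfl))
    ((hc.coprime_dvd_right (Dvd.intro_left _ rfl)).pow_right n)

omit [NeZero N] in
/-- **Change of variables `x ↦ cx` with a character** (Lang Ch. 2 §2, proof of Thm. 2.4: "We let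
`x ↦ cx` in the second integral. Then `ψ(c)` comes out as a factor"), for `ψ(b) = ρ(b̄)θ(b)`:
`∑_{b mod M} ρ(b̄)θ(b) B_k((bc⁻¹).val/M) = ρ(c)θ(c) ∑_{b mod M} ρ(b̄)θ(b) B_k(b.val/M)` (`N ∣ M`,
`p^n ∣ M`, `c` prime to `M`, `b̄` the class of `b` modulo `p^n`). [cite: LangCyclotomic1990, Ch. 2 §2, proof of Thm. 2.4 (PDF p. 38)] -/
theorem sum_character_mul_bernoulliDist_mul_inv {M n : ℕ} [NeZero M] (hNM : N ∣ M)
    (hpM : p ^ n ∣ M) (hcM : c.Coprime M) (hθ : ∀ b, θ (b + N) = θ b)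
    (hθc : ∀ x, θ (c * x) = θ c * θ x) (ρ : MulChar (ZMod (p ^ n)) ℂ_[p]) (k : ℕ) :
    ∑ b : ZMod M, ρ (ZMod.castHom hpM (ZMod (p ^ n)) b) *
        algebraMap ℚ_[p] ℂ_[p] (((θ b.val : ℤ_[p]) : ℚ_[p]) *
          ((bernoulliDist k M (b * (c : ZMod M)⁻¹) : ℚ) : ℚ_[p])) =
      ρ (c : ZMod (p ^ n)) * algebraMap ℚ_[p] ℂ_[p] ((θ c : ℤ_[p]) : ℚ_[p]) *
        ∑ b : ZMod M, ρ (ZMod.castHom hpM (ZMod (p ^ n)) b) *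
          algebraMap ℚ_[p] ℂ_[p] (((θ b.val : ℤ_[p]) : ℚ_[p]) * ((bernoulliDist k M b : ℚ) : ℚ_[p])) := by
  have hcc : (c : ZMod M) * (c : ZMod M)⁻¹ = 1 := ZMod.coe_mul_inv_eq_one c hcM
  set u : (ZMod M)ˣ := ZMod.unitOfCoprime c hcM with hu
  set ι : ℚ_[p] →+* ℂ_[p] := algebraMap ℚ_[p] ℂ_[p] with hι
  set F : ZMod M → ℂ_[p] := fun b ↦ ρ (ZMod.castHom hpM (ZMod (p ^ n)) b) *
    ι (((θ b.val : ℤ_[p]) : ℚ_[p]) * ((bernoulliDist k M (b * (c : ZMod M)⁻¹) : ℚ) : ℚ_[p])) with hF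
  have hreindex : ∑ b : ZMod M, F b = ∑ b : ZMod M, F (b * (c : ZMod M)) :=
    (Fintype.sum_equiv (Units.mulRight u) (fun b ↦ F (b * (c : ZMod M))) F fun b ↦ by
      rw [Units.mulRight_apply, hu, ZMod.coe_unitOfCoprime]).symm
  rw [hreindex, Finset.mul_sum]
  refine Finset.sum_congr rfl fun b _ ↦ ?_
  rw [hF]
  dsimp only
  rw [mul_assoc b, hcc, mul_one, map_mul (ZMod.castHom hpM (ZMod (p ^ n))), map_natCast, map_mul ρ,
    apply_val_mul_natCast p hNM hθ hθc, PadicInt.coe_mul, map_mul ι, map_mul ι, map_mul ι]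
  ring

/-! ### The character sum of `θE_{1,c}` at level `p^n` -/

/-- **`∫ ρ d(θE_{1,c}) = (1 − θ(c)ρ(c)c) · B_{1,θρ}`** (Lang Ch. 2 §2 Thm. 2.4 at `k = 1` for the
function `ψ = θρ` on `ℤ/Np^nℤ`, with **B 7** `B_{1,ψ} = ∑_{x mod M} ψ(x)B_1(x/M)`): for `θ` of
period `N` multiplicative with respect to `c`, `c` prime to `Np`, and a multiplicative character
`ρ` of `ℤ/p^nℤ` with values in `ℂ_p`,
`∑_{a mod p^n} ρ(a)·(θE_{1,c})(a + p^nℤ_p) = (1 − θ(c)ρ(c)c) ∑_{b mod Np^n} ρ(b̄)θ(b)B_1(b.val/(Np^n))`.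
This is the value `f(ρ(γ) − 1)` of the Iwasawa function of `θE_{1,c}` before regularisation
(Lang Ch. 4 §3 Thm. 3.2 at a character of finite order). [cite: LangCyclotomic1990, Ch. 2 §2, Thm. 2.4 with its proof (PDF p. 38) and B 7 (PDF p. 35)] -/
theorem sum_character_mul_bernoulliMeasure_one (hc : c.Coprime (N * p)) (hθ : ∀ b, θ (b + N) = θ b)
    (hθc : ∀ x, θ (c * x) = θ c * θ x) (n : ℕ) (ρ : MulChar (ZMod (p ^ n)) ℂ_[p]) :
    ∑ a : ZMod (p ^ n), ρ a * algebraMap ℚ_[p] ℂ_[p] (bernoulliMeasure p N c θ 1 n a) =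
      (1 - algebraMap ℚ_[p] ℂ_[p] ((θ c : ℤ_[p]) : ℚ_[p]) * ρ (c : ZMod (p ^ n)) * (c : ℂ_[p])) *
        ∑ b : ZMod (N * p ^ n), ρ (ZMod.castHom (Dvd.intro_left N rfl) (ZMod (p ^ n)) b) *
          algebraMap ℚ_[p] ℂ_[p] (((θ b.val : ℤ_[p]) : ℚ_[p]) *
            ((bernoulliDist 1 (N * p ^ n) b : ℚ) : ℚ_[p])) := by
  have hcM : c.Coprime (N * p ^ n) := coprime_mul_pow' p hc n
  set ι : ℚ_[p] →+* ℂ_[p] := algebraMap ℚ_[p] ℂ_[p] with hι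
  set g : ZMod (N * p ^ n) →+* ZMod (p ^ n) := ZMod.castHom (Dvd.intro_left N rfl) (ZMod (p ^ n))
    with hg
  -- Step 1: unfold the measure and sum fibrewise
  have h1 : ∑ a : ZMod (p ^ n), ρ a * ι (bernoulliMeasure p N c θ 1 n a) =
      ∑ b : ZMod (N * p ^ n), ρ (g b) * ι (((θ b.val : ℤ_[p]) : ℚ_[p]) *
        (((regBernoulliDist 1 (N * p ^ n) c b / (1 : ℕ) : ℚ)) : ℚ_[p])) := by
    unfold bernoulliMeasure
    have hin : ∀ a : ZMod (p ^ n),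
        ρ a * ι (∑ b ∈ Finset.univ.filter (fun b : ZMod (N * p ^ n) ↦ g b = a),
          ((θ b.val : ℤ_[p]) : ℚ_[p]) * (((regBernoulliDist 1 (N * p ^ n) c b / (1 : ℕ) : ℚ)) : ℚ_[p])) =
        ∑ b ∈ Finset.univ.filter (fun b : ZMod (N * p ^ n) ↦ g b = a),
          ρ (g b) * ι (((θ b.val : ℤ_[p]) : ℚ_[p]) *
            (((regBernoulliDist 1 (N * p ^ n) c b / (1 : ℕ) : ℚ)) : ℚ_[p])) := by
      intro a
      rw [map_sum, Finset.mul_sum]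
      refine Finset.sum_congr rfl fun b hb ↦ ?_
      rw [(Finset.mem_filter.mp hb).2]
    rw [Finset.sum_congr rfl fun a _ ↦ hin a, Finset.sum_fiberwise]
  -- Step 2: expand `E_{1,c} = E_1 − c E_1 ∘ c⁻¹` and change variables in the second sum
  have hterm : ∀ b : ZMod (N * p ^ n),
      ρ (g b) * ι (((θ b.val : ℤ_[p]) : ℚ_[p]) *
        (((regBernoulliDist 1 (N * p ^ n) c b / (1 : ℕ) : ℚ)) : ℚ_[p])) =
      ρ (g b) * ι (((θ b.val : ℤ_[p]) : ℚ_[p]) * ((bernoulliDist 1 (N * p ^ n) b : ℚ) : ℚ_[p])) -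
        (c : ℂ_[p]) * (ρ (g b) * ι (((θ b.val : ℤ_[p]) : ℚ_[p]) *
          ((bernoulliDist 1 (N * p ^ n) (b * (c : ZMod (N * p ^ n))⁻¹) : ℚ) : ℚ_[p]))) := by
    intro b
    simp only [regBernoulliDist, Nat.cast_one, div_one, pow_one, Rat.cast_sub, Rat.cast_mul,
      Rat.cast_natCast, mul_sub, map_sub, map_mul, map_natCast]
    ring
  rw [h1, Finset.sum_congr rfl fun b _ ↦ hterm b, Finset.sum_sub_distrib, ← Finset.mul_sum, hg,
    sum_character_mul_bernoulliDist_mul_inv p (Dvd.intro _ rfl) (Dvd.intro_left N rfl) hcM hθ hθc ρ 1]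
  ring

/-! ### The character sum of the inverted distribution -/

variable {p}

/-- **The character sum of the inverted distribution**: for a distribution `μ` on `ℤ_p` and its
push-forward `μ̌` of `μ|_{ℤ_pˣ}` along `x ↦ x⁻¹`
(`invUnitsDist`; Lang Ch. 4 §2, operations on measures), `∑_{a mod p^n} ρ(a) μ̌(a + p^nℤ_p) =
∑_{a mod p^n} ρ⁻¹(a) μ(a + p^nℤ_p)` for every multiplicative character `ρ` of `ℤ/p^nℤ`
(`∫ ρ dμ̌ = ∫ ρ(x⁻¹) dμ`). [cite: LangCyclotomic1990, Ch. 4 §2 (operations on measures: push-forward, PDF pp. 80–82)] -/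
theorem sum_character_mul_invUnitsDist (μ : (n : ℕ) → ZMod (p ^ n) → ℚ_[p]) (n : ℕ)
    (ρ : MulChar (ZMod (p ^ n)) ℂ_[p]) :
    ∑ a : ZMod (p ^ n), ρ a * algebraMap ℚ_[p] ℂ_[p] (invUnitsDist μ n a) =
      ∑ a : ZMod (p ^ n), ρ⁻¹ a * algebraMap ℚ_[p] ℂ_[p] (μ n a) := by
  -- the involution `σ(a) = a⁻¹` on units, `σ(a) = a` on non-units
  set σ : ZMod (p ^ n) → ZMod (p ^ n) := fun a ↦
    if h : IsUnit a then ((h.unit⁻¹ : (ZMod (p ^ n))ˣ) : ZMod (p ^ n)) else a with hσ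
  have hσu : ∀ (a : ZMod (p ^ n)) (h : IsUnit a),
      σ a = ((h.unit⁻¹ : (ZMod (p ^ n))ˣ) : ZMod (p ^ n)) := fun a h ↦ by rw [hσ]; exact dif_pos h
  have hσn : ∀ (a : ZMod (p ^ n)), ¬ IsUnit a → σ a = a := fun a h ↦ by rw [hσ]; exact dif_neg h
  have hinv : Function.Involutive σ := by
    intro a
    by_cases h : IsUnit a
    · have h' : IsUnit ((h.unit⁻¹ : (ZMod (p ^ n))ˣ) : ZMod (p ^ n)) := Units.isUnit _
      rw [hσu a h, hσu _ h', IsUnit.unit_of_val_units, inv_inv, IsUnit.unit_spec]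
    · rw [hσn a h, hσn a h]
  -- both summands agree after the substitution `a ↦ σ(a)`
  refine Fintype.sum_bijective σ hinv.bijective _ _ fun a ↦ ?_
  by_cases h : IsUnit a
  · rw [hσu a h, invUnitsDist, dif_pos h, MulChar.inv_apply, Ring.inverse_unit, inv_inv,
      IsUnit.unit_spec]
  · rw [hσn a h, invUnitsDist, dif_neg h, map_zero, mul_zero, MulChar.map_nonunit _ h, zero_mul]

end Literature.NumberTheory.EllipticCurves

end
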